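import Literature.Combinatorics.SimpleGraph.TreeAutomorphismDisplacement   -- ★ `TreeDisplacement.exists_path_two_mul`, `dist_eq_length_of_isPath` (F0P3a-p08 (g17))
import Literature.Combinatorics.SimpleGraph.TreeHereditaryLayerCount       -- ★ `TreeLayers.*` layer recursions, hereditary form (F0P3a-p08 (g17))
import HarnessLib

/-!
# The displacement shells of an elliptic tree automorphism obey the layer recursion: `#{d(v, αv) = 2(k+1), type i} = q_j · #{d(v, αv) = 2k, type j}` (Serre, *Trees* I.2.3, I.6.4)

Topic `Combinatorics/SimpleGraph`; namespace `Literature.Combinatorics.SimpleGraph.TreeDisplacement` (extends ★ `TreeAutomorphismDisplacement`).  THEOREMS ONLY (no definition, no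
instance, no notation, no named fact, no `sorry`); arbitrary vertex type.  Cell `pub/hodgecm-mathlib`, F0∕P3a, crux H413 = `stmt-HodgeConjecture-24833`, line «N6nsGerm», residue
`stub_N6nsS3id`, road «S3-tree» (deal sheet CENSUS «S3» v3: «T2-core ★ p845190 … `Fix γ`, shells, `C_k(γ)` instantiate ★ p845190 on `latticeGraphIso … (E γ)`»; LAW SHEET L5 «tree lemma
⇒ Hecke rows = sphere counts `C_k`»).  THE BRIDGE between ★ `TreeAutomorphismDisplacement` (`d(v, αv) = 2·h(v)`) and ★ `TreeSubtreeLayerCount` ∕ `TreeHereditaryLayerCount` (layer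
recursions for the SAME retraction data `(h, p)` onto `Fix α`): the consumer gets the recursion for the displacement shells `C_k(α) ∩ type` DIRECTLY, with no height function in the
statement.  Written by F0P3a-p08 (g17) («tree organs» hand).  HONEST LABEL: HC_CM is proved only modulo the printed citations (the 2 remaining named inputs hLiu418, h413) until rung 0
closes; pure graph theory here.

* §1 **`exists_height_parent`** — ONE package of retraction data onto `Fix α` carrying everything: `h v = 0 ↔ α v = v`, parent step, children clause, `h ∘ α = h`, the distance clause,
  and the displacement identity `G.dist v (α v) = 2 * h v`.
* §2 (ELLIPTIC, `Fix α` finite, `G` locally finite) **`finite_setOf_dist_self_apply_eq`** (every displacement shell is finite); **`ncard_displaced_succ_inter_type_eq`** — for a type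
  function `c` (adjacent vertices of different types) and degrees `q (c v) + 1` off `Fix α`, `k ≥ 1`, `i ≠ j`:
  `#{w | d(w, αw) = 2(k+1), c w = i} = q j · #{v | d(v, αv) = 2k, c v = j}` — the `C_k(γ)` recursion of road «S3-tree» in its own currency.
* §3 (PER PERIOD, `Fix α` possibly infinite) the same with an extra predicate `P` CONSTANT ALONG EVERY EDGE WITH A MOVED ENDPOINT (`α w ≠ w → w ~ v → (P w ↔ P v)`, e.g. «the branch
  of `w` hangs off the fundamental domain `D`»), finiteness from `Fix α ∩ P`: **`ncard_displaced_succ_inter_type_eq_of_edgeConst`**.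

## References
* [Serre1980Trees] J.-P. Serre, *Trees*, Springer (1980): I.2.3 (projection onto a subtree), I.6.4 Prop. 24–25, II.1.1.
* [Diestel2010] R. Diestel, *Graph Theory*, 4th ed., Thm. 1.5.1.
-/

set_option autoImplicit false

open SimpleGraph

namespace Literature.Combinatorics.SimpleGraph.TreeDisplacement

variable {V : Type*} {G : SimpleGraph V}

/-! ## §1 One package of retraction data onto `Fix α` -/

/-- **Retraction data onto the fixed subtree, with the displacement identity.**  For a tree `G` and `α : G ≃g G` with a fixed vertex there are `h : V → ℕ`, `p : V → V` with:
(dist) `h v` is the distance to `Fix α` (attained, minimal); (P1) `h v = 0 ↔ α v = v`; (P2) `v ~ p v`, `h (p v) + 1 = h v` when `α v ≠ v`; (P5) a neighbour `w ≠ p v` of a moved `v`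
has `h w = h v + 1 ∧ p w = v`; (P4) `h (α v) = h v`; and (DISP) `G.dist v (α v) = 2 * h v`. [cite: Serre1980Trees, I.6.4 Prop. 24] [cite: Serre1980Trees, I.2.3] -/
theorem exists_height_parent (hT : G.IsTree) (α : G ≃g G) {u : V} (hu : α u = u) :
    ∃ (h : V → ℕ) (p : V → V),
      (∀ v, (∃ y, α y = y ∧ G.dist v y = h v) ∧ ∀ y, α y = y → h v ≤ G.dist v y) ∧
      (∀ v, h v = 0 ↔ α v = v) ∧
      (∀ v, α v ≠ v → G.Adj v (p v) ∧ h (p v) + 1 = h v) ∧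
      (∀ v w, α v ≠ v → G.Adj v w → w ≠ p v → h w = h v + 1 ∧ p w = v) ∧
      (∀ v, h (α v) = h v) ∧
      (∀ v, G.dist v (α v) = 2 * h v) := by
  have hYne : ({y | α y = y} : Set V).Nonempty := ⟨u, hu⟩
  have hYc : (G.induce {y | α y = y}).Connected := BakerNorine.connected_induce_fixed hT α hu
  obtain ⟨h, p, hdist, h0, hpar, -, hchild, hequi⟩ := TreeRetraction.exists_retraction hT hYne hYc
  have hαY : ∀ v, α v ∈ ({y | α y = y} : Set V) ↔ v ∈ ({y | α y = y} : Set V) := fun v => by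
    simp only [Set.mem_setOf_eq]
    exact α.injective.eq_iff
  have hα : ∀ v, h (α v) = h v := fun v => (hequi α hαY v).1
  refine ⟨h, p, fun v => ⟨?_, fun y hy => (hdist v).2 y hy⟩, h0, fun v hv => hpar v hv, fun v w hv => hchild v w hv, hα, fun v => ?_⟩
  · obtain ⟨y, hy, hd⟩ := (hdist v).1
    exact ⟨y, hy, hd⟩
  · obtain ⟨W, hW, hWl, -⟩ := exists_path_two_mul α h p h0 (fun v hv => hpar v hv) hα (h v) v rfl
    rw [dist_eq_length_of_isPath hT hW, hWl]

/-! ## §2 The displacement shells of an elliptic automorphism (`Fix α` finite) -/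

/-- **Every displacement shell `{v | d(v, αv) = 2k}` is finite** when `Fix α` is finite and non-empty (locally finite tree); odd shells are empty (★ `setOf_dist_self_apply_eq`).
[cite: Serre1980Trees, I.6.4 Prop. 24] -/
theorem finite_setOf_dist_self_apply_eq [G.LocallyFinite] (hT : G.IsTree) (α : G ≃g G) {u : V} (hu : α u = u) (hfin : {v | α v = v}.Finite) (k : ℕ) :
    {v | G.dist v (α v) = 2 * k}.Finite := by
  obtain ⟨h, p, -, h0, hpar, hchild, -, hdisp⟩ := exists_height_parent hT α hu
  have h0' : ∀ v, h v = 0 ↔ v ∈ ({y | α y = y} : Set V) := h0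
  have hfk := TreeLayers.finite_layer (Y := {y | α y = y}) h0' (fun v hv => hpar v hv) (fun v w hv => hchild v w hv) hfin k
  refine hfk.subset fun v hv => ?_
  rw [Set.mem_setOf_eq] at hv ⊢
  rw [hdisp] at hv
  omega

/-- **THE `C_k` RECURSION IN DISPLACEMENT CURRENCY (elliptic case).**  `G` a locally finite tree, `α : G ≃g G` with finite non-empty fixed set, `c : V → Fin 2` a type function
(adjacent vertices of different types), every MOVED vertex of type `j` of degree `q j + 1`.  Then for `k ≥ 1` and `i ≠ j`:
`#{w | d(w, αw) = 2(k+1) ∧ c w = i} = q j · #{v | d(v, αv) = 2k ∧ c v = j}`. [cite: Serre1980Trees, I.6.4 Prop. 24] [cite: Serre1980Trees, II.1.1] -/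
theorem ncard_displaced_succ_inter_type_eq [G.LocallyFinite] (hT : G.IsTree) (α : G ≃g G) {u : V} (hu : α u = u) (hfin : {v | α v = v}.Finite)
    (c : V → Fin 2) (hc : ∀ v w, G.Adj v w → c v ≠ c w) (q : Fin 2 → ℕ) (hdeg : ∀ v, α v ≠ v → G.degree v = q (c v) + 1)
    {i j : Fin 2} (hij : i ≠ j) {k : ℕ} (hk : 1 ≤ k) :
    {w | G.dist w (α w) = 2 * (k + 1) ∧ c w = i}.ncard = q j * {v | G.dist v (α v) = 2 * k ∧ c v = j}.ncard := by
  obtain ⟨h, p, -, h0, hpar, hchild, -, hdisp⟩ := exists_height_parent hT α hu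
  have h0' : ∀ v, h v = 0 ↔ v ∈ ({y | α y = y} : Set V) := h0
  have key := TreeLayers.ncard_layer_succ_inter_type_eq (Y := {y | α y = y}) h0' (fun v hv => hpar v hv) (fun v w hv => hchild v w hv) hfin c hc q
    (fun v hv => hdeg v hv) hij hk
  have e1 : {w | G.dist w (α w) = 2 * (k + 1) ∧ c w = i} = {w | h w = k + 1 ∧ c w = i} := by
    ext w; simp only [Set.mem_setOf_eq, hdisp]; omega
  have e2 : {v | G.dist v (α v) = 2 * k ∧ c v = j} = {v | h v = k ∧ c v = j} := by
    ext v; simp only [Set.mem_setOf_eq, hdisp]; omega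
  rw [e1, e2, key]

/-! ## §3 Per-period version: an edge-constant predicate -/

/-- **THE `C_k` RECURSION PER PERIOD.**  As in §2, but `Fix α` may be infinite (a tube axis); instead a predicate `P`, constant along every edge with a MOVED endpoint
(`α w ≠ w → w ~ v → (P w ↔ P v)`; e.g. «`w` hangs off the fundamental domain `D` of the axis»), with `Fix α ∩ P` finite, cuts the shells:
`#{w | d(w, αw) = 2(k+1) ∧ c w = i ∧ P w} = q j · #{v | d(v, αv) = 2k ∧ c v = j ∧ P v}` (`k ≥ 1`, `i ≠ j`). [cite: Serre1980Trees, I.6.4 Prop. 24–25] -/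
theorem ncard_displaced_succ_inter_type_eq_of_edgeConst [G.LocallyFinite] (hT : G.IsTree) (α : G ≃g G) {u : V} (hu : α u = u)
    {P : V → Prop} (hP : ∀ v w, α w ≠ w → G.Adj w v → (P w ↔ P v)) (hD : {v | α v = v ∧ P v}.Finite)
    (c : V → Fin 2) (hc : ∀ v w, G.Adj v w → c v ≠ c w) (q : Fin 2 → ℕ) (hdeg : ∀ v, α v ≠ v → G.degree v = q (c v) + 1)
    {i j : Fin 2} (hij : i ≠ j) {k : ℕ} (hk : 1 ≤ k) :
    {w | G.dist w (α w) = 2 * (k + 1) ∧ c w = i ∧ P w}.ncard = q j * {v | G.dist v (α v) = 2 * k ∧ c v = j ∧ P v}.ncard := by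
  obtain ⟨h, p, -, h0, hpar, hchild, -, hdisp⟩ := exists_height_parent hT α hu
  have h0' : ∀ v, h v = 0 ↔ v ∈ ({y | α y = y} : Set V) := h0
  have hP' : ∀ w, w ∉ ({y | α y = y} : Set V) → (P w ↔ P (p w)) := fun w hw => hP (p w) w hw (hpar w hw).1
  have hD' : {v | v ∈ ({y | α y = y} : Set V) ∧ P v}.Finite := hD
  have key := TreeLayers.ncard_layer_succ_inter_type_eq_of_hereditary (Y := {y | α y = y}) h0' (fun v hv => hpar v hv) (fun v w hv => hchild v w hv)
    hP' hD' c hc q (fun v hv => hdeg v hv) hij hk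
  have e1 : {w | G.dist w (α w) = 2 * (k + 1) ∧ c w = i ∧ P w} = {w | h w = k + 1 ∧ c w = i ∧ P w} := by
    ext w
    simp only [Set.mem_setOf_eq, hdisp]
    exact ⟨fun hw => ⟨by omega, hw.2.1, hw.2.2⟩, fun hw => ⟨by omega, hw.2.1, hw.2.2⟩⟩
  have e2 : {v | G.dist v (α v) = 2 * k ∧ c v = j ∧ P v} = {v | h v = k ∧ c v = j ∧ P v} := by
    ext v
    simp only [Set.mem_setOf_eq, hdisp]
    exact ⟨fun hv => ⟨by omega, hv.2.1, hv.2.2⟩, fun hv => ⟨by omega, hv.2.1, hv.2.2⟩⟩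
  rw [e1, e2, key]


/-! ## §4 (ED. 2) The same heads in `ncard`-valency currency

ED. 2 (F0P3a-p08 (g17), same day; previous declarations byte-identical).  The lattice-tree consumers (T1∕T2-S, HANDOFF-T2S-fold fbca9750 §2 (b): «valencies `q³+1 ∕ q+1` must come BY
NAME from T1's neighbour counts — which ★ head gives `G.degree v` per type?») state valencies as `(G.neighborSet v).ncard = …` and finiteness as `(G.neighborSet v).Finite`, with no
`LocallyFinite` instance in the tree.  These wrappers take exactly that: they build the (noncomputable) `LocallyFinite` structure from `hnb : ∀ v, (G.neighborSet v).Finite` inside the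
proof and translate `G.degree v = (G.neighborSet v).ncard`. -/

/-- Under any `LocallyFinite` structure, `G.degree v = (G.neighborSet v).ncard`. [cite: Diestel2010, §1.2] -/
theorem degree_eq_ncard_neighborSet [G.LocallyFinite] (v : V) : G.degree v = (G.neighborSet v).ncard := by
  rw [← card_neighborSet_eq_degree, Set.ncard_eq_toFinset_card', Set.toFinset_card]

/-- **`C_k` recursion (elliptic), `ncard`-valency form**: as `ncard_displaced_succ_inter_type_eq` with `hnb : ∀ v, (G.neighborSet v).Finite` and
`hdeg : α v ≠ v → (G.neighborSet v).ncard = q (c v) + 1` instead of a `LocallyFinite` instance and `G.degree`. [cite: Serre1980Trees, I.6.4 Prop. 24] [cite: Serre1980Trees, II.1.1] -/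
theorem ncard_displaced_succ_inter_type_eq' (hT : G.IsTree) (α : G ≃g G) {u : V} (hu : α u = u) (hfin : {v | α v = v}.Finite) (hnb : ∀ v, (G.neighborSet v).Finite)
    (c : V → Fin 2) (hc : ∀ v w, G.Adj v w → c v ≠ c w) (q : Fin 2 → ℕ) (hdeg : ∀ v, α v ≠ v → (G.neighborSet v).ncard = q (c v) + 1)
    {i j : Fin 2} (hij : i ≠ j) {k : ℕ} (hk : 1 ≤ k) :
    {w | G.dist w (α w) = 2 * (k + 1) ∧ c w = i}.ncard = q j * {v | G.dist v (α v) = 2 * k ∧ c v = j}.ncard := by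
  haveI : G.LocallyFinite := fun v => (hnb v).fintype
  exact ncard_displaced_succ_inter_type_eq hT α hu hfin c hc q (fun v hv => by rw [degree_eq_ncard_neighborSet]; exact hdeg v hv) hij hk

/-- **`C_k` recursion per period, `ncard`-valency form** (see `ncard_displaced_succ_inter_type_eq_of_edgeConst`). [cite: Serre1980Trees, I.6.4 Prop. 24–25] -/
theorem ncard_displaced_succ_inter_type_eq_of_edgeConst' (hT : G.IsTree) (α : G ≃g G) {u : V} (hu : α u = u)
    {P : V → Prop} (hP : ∀ v w, α w ≠ w → G.Adj w v → (P w ↔ P v)) (hD : {v | α v = v ∧ P v}.Finite) (hnb : ∀ v, (G.neighborSet v).Finite)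
    (c : V → Fin 2) (hc : ∀ v w, G.Adj v w → c v ≠ c w) (q : Fin 2 → ℕ) (hdeg : ∀ v, α v ≠ v → (G.neighborSet v).ncard = q (c v) + 1)
    {i j : Fin 2} (hij : i ≠ j) {k : ℕ} (hk : 1 ≤ k) :
    {w | G.dist w (α w) = 2 * (k + 1) ∧ c w = i ∧ P w}.ncard = q j * {v | G.dist v (α v) = 2 * k ∧ c v = j ∧ P v}.ncard := by
  haveI : G.LocallyFinite := fun v => (hnb v).fintype
  exact ncard_displaced_succ_inter_type_eq_of_edgeConst hT α hu hP hD c hc q (fun v hv => by rw [degree_eq_ncard_neighborSet]; exact hdeg v hv) hij hk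

/-- **Displacement shells are finite, `ncard`-valency form** (see `finite_setOf_dist_self_apply_eq`). [cite: Serre1980Trees, I.6.4 Prop. 24] -/
theorem finite_setOf_dist_self_apply_eq' (hT : G.IsTree) (α : G ≃g G) {u : V} (hu : α u = u) (hfin : {v | α v = v}.Finite) (hnb : ∀ v, (G.neighborSet v).Finite)
    (k : ℕ) : {v | G.dist v (α v) = 2 * k}.Finite := by
  haveI : G.LocallyFinite := fun v => (hnb v).fintype
  exact finite_setOf_dist_self_apply_eq hT α hu hfin k

/-- **Bi-regular spheres, `ncard`-valency form** (see ★ `TreeLayers.ncard_sphere_eq_of_biregular`): `#{v | G.dist r v = m} = (q a + 1)·(q b)^{⌊m∕2⌋}·(q a)^{⌊(m−1)∕2⌋}` for `m ≥ 1`.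
[cite: Serre1980Trees, II.1.1] -/
theorem ncard_sphere_eq_of_biregular' (hT : G.IsTree) (hnb : ∀ v, (G.neighborSet v).Finite) (r : V) (c : V → Fin 2) (hc : ∀ v w, G.Adj v w → c v ≠ c w) (q : Fin 2 → ℕ)
    (hdeg : ∀ v, (G.neighborSet v).ncard = q (c v) + 1) {a b : Fin 2} (ha : c r = a) (hab : a ≠ b) {m : ℕ} (hm : 1 ≤ m) :
    {v | G.dist r v = m}.ncard = (q a + 1) * q b ^ (m / 2) * q a ^ ((m - 1) / 2) := by
  haveI : G.LocallyFinite := fun v => (hnb v).fintype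
  exact TreeLayers.ncard_sphere_eq_of_biregular hT r c hc q (fun v => by rw [degree_eq_ncard_neighborSet]; exact hdeg v) ha hab hm

end Literature.Combinatorics.SimpleGraph.TreeDisplacement
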